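import Mathlib
import Summits.ValiantsHypothesis.ValiantsHypothesis.Theorems.BarrierLeverPartitionMinorsHitByVPSimplexJoinBigPiece
import Summits.ValiantsHypothesis.ValiantsHypothesis.Theorems.BarrierLeverPartitionMinorsHitByVPUniformMenu

/-!
# Route BarrierLever — item `PartitionMinorsHitByVP` (19717): the uniform simplex menu REDUCED TO ONE PIECE-LEVEL STATEMENT
Helper file (`--supports stmt-ValiantsHypothesis-19717`; cell valiant-natproofs, 𝒟-side door (c), line `hidden_states`, uniform-menu
lane; prover seat val-np-p3 gen 12). One `Prop` definition (`Stmt.pieceKill`, NOT asserted) and its kernel consequence. Closes NO item.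

`Stmt.pieceKill H₀` (typed here) says: for `h ≥ H₀`, every ONE-piece exact-support design with two live slots, widths `≤ (2h)²`, and a number
of columns `n` with `(2h)² + 2 ≤ n ≤ (2h)²((2h)²+1) + 1` is defeated by some injective row family for EVERY table. By the (T)-gap finding
(memo val-np-p3 g12 §2) this holds numerically from `h ≈ 2000`, and the seat's toolkit (`…TwoDeep`, `…TwoDeepRank`, `…TwoSlotsLevels`,
`…ThreeSlots` … `…SixSlots`, `…AffineDeficit`, template `…WidestSquare`) is the kernel material for its proof by the case map of memo §2(f)–(g).
**`not_uniformMenuSimplex_of_pieceKill : Stmt.pieceKill H₀ → ¬ Stmt.uniformMenuSimplex`**: at `r := (2h)²((2h)²+1)+1 ≤ 2^h` every design within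
budget has a piece with `≥ (2h)²+2` columns and two live slots (`exists_big_piece`), and the piece restriction (`pieceDesign`,
`not_uniform_of_pieceDesign`) turns `Stmt.pieceKill` into the failure of that piece's uniformity clause. So the by-name-credited node
`Stmt.uniformMenuSimplex` (p623583) is REFUTED in the kernel as soon as `Stmt.pieceKill H₀` lands for one `H₀`.
Nothing on `Stmt.simplexUniversal`, on the registered `stub_simplexPairLower`, on crux 14610 or VP ≠ VNP; item 19717 stays OPEN.
-/

set_option linter.dupNamespace false

namespace Summit.ValiantsHypothesis.ValiantsHypothesis.Theorems.BarrierLever.SimplexJoin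

open Finset Matrix

/-- **The piece-level statement (typed, not asserted).** From `H₀` on, every one-piece exact-support design with two live slots, widths
`≤ (2h)²`, and `(2h)²+2 ≤ n ≤ (2h)²((2h)²+1)+1` columns has an injective row family on which every table is singular. -/
def Stmt.pieceKill (H₀ : ℕ) : Prop :=
  ∀ h : ℕ, H₀ ≤ h → ∀ (D N n : ℕ) (S : Fin 1 → Fin D → Finset (Fin N)) (e : Fin n → Fin 1 × (Fin D → Option (Fin N))),
    D ≤ h + h → N ≤ (h + h) ^ 2 → Function.Injective e →
    (∀ c : Fin 1 × (Fin D → Option (Fin N)), c ∈ Set.range e ↔ ∀ (f : Fin D) (j : Fin N), c.2 f = some j → j ∈ S c.1 f) →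
    (∃ f₁ f₂ : Fin D, f₁ ≠ f₂ ∧ (S 0 f₁).Nonempty ∧ (S 0 f₂).Nonempty) →
    (h + h) ^ 2 + 2 ≤ n → n ≤ (h + h) ^ 2 * ((h + h) ^ 2 + 1) + 1 →
    ∃ v : Fin n → Finset (Fin h), Function.Injective v ∧
      ∀ T : Fin 1 → Option (Fin D × Fin N) → Fin h → ℂ,
        (Matrix.of fun x x' : Fin n => ∏ a ∈ v x,
          (T (e x').1 none a + ∑ f : Fin D, ((e x').2 f).elim 0 fun j => T (e x').1 (some (f, j)) a)).det = 0

/-- Arithmetic: `(2h)²((2h)²+1) + 1 ≤ 2^h` for `h ≥ 33`. -/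
theorem menu_r_le_two_pow (h : ℕ) (hh : 33 ≤ h) : (h + h) ^ 2 * ((h + h) ^ 2 + 1) + 1 ≤ 2 ^ h := by
  have key : ∀ n, 33 ≤ n → 17 * n ^ 4 ≤ 2 ^ n := by
    intro n hn
    induction n, hn using Nat.le_induction with
    | base => norm_num
    | succ k hk ih =>
      have h4 : (k + 1) ^ 4 ≤ 2 * k ^ 4 := by
        have : 33 * k ^ 3 ≤ k ^ 4 := by
          calc 33 * k ^ 3 ≤ k * k ^ 3 := Nat.mul_le_mul_right _ hk
            _ = k ^ 4 := by ring
        nlinarith [this, Nat.zero_le k]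
      calc 17 * (k + 1) ^ 4 ≤ 17 * (2 * k ^ 4) := Nat.mul_le_mul_left _ h4
        _ = 2 * (17 * k ^ 4) := by ring
        _ ≤ 2 * 2 ^ k := Nat.mul_le_mul_left _ ih
        _ = 2 ^ (k + 1) := by ring
  have h1 : (h + h) ^ 2 * ((h + h) ^ 2 + 1) + 1 ≤ 17 * h ^ 4 := by
    have hsq : 33 * 33 ≤ h ^ 2 := by nlinarith
    have h4 : 4 * h ^ 2 + 1 ≤ h ^ 4 := by
      have : h ^ 4 = h ^ 2 * h ^ 2 := by ring
      rw [this]; nlinarith [hsq]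
    have : (h + h) ^ 2 * ((h + h) ^ 2 + 1) + 1 = 16 * h ^ 4 + 4 * h ^ 2 + 1 := by ring
    rw [this]; omega
  exact h1.trans (key h hh)

/-- **The uniform simplex menu reduces to `Stmt.pieceKill`.** -/
theorem not_uniformMenuSimplex_of_pieceKill (H₀ : ℕ) (hPK : Stmt.pieceKill H₀) : ¬ Stmt.uniformMenuSimplex := by
  classical
  rintro ⟨h₁, H⟩
  set h := max h₁ (max H₀ 33) with hh
  have hh₁ : h₁ ≤ h := le_max_left _ _
  have hH₀ : H₀ ≤ h := le_trans (le_max_left _ _) (le_max_right _ _)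
  have h33 : 33 ≤ h := le_trans (le_max_right _ _) (le_max_right _ _)
  set Nb := (h + h) ^ 2 with hNb
  set r := Nb * (Nb + 1) + 1 with hr
  have hr2 : r ≤ 2 ^ h := menu_r_le_two_pow h h33
  obtain ⟨m, D, N, S, e, hm, hD, hN, he, hlive, hU⟩ := H h hh₁ r hr2
  -- a big piece with two live slots
  have hmr : m * (N + 1) < r := by
    calc m * (N + 1) ≤ Nb * (Nb + 1) := Nat.mul_le_mul hm (by omega)
      _ < r := by omega
  obtain ⟨p, hbig, f₁, f₂, hf, hS₁, hS₂⟩ := exists_big_piece S e he hlive hmr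
  -- enumerate the columns of `p`
  set P := Finset.univ.filter (fun k => (e k).1 = p) with hP
  set n := P.card with hn
  let c : Fin n → Fin r := fun x => (P.orderEmbOfFin rfl x : Fin r)
  have hc : Function.Injective c := fun x x' hxx' => (P.orderEmbOfFin rfl).injective hxx'
  have hcP : ∀ x, c x ∈ P := fun x => P.orderEmbOfFin_mem rfl x
  have hcp : ∀ x, (e (c x)).1 = p := fun x => (Finset.mem_filter.mp (hcP x)).2
  have hsurj : ∀ k, (e k).1 = p → ∃ x, c x = k := by
    intro k hk
    have hkP : k ∈ P := Finset.mem_filter.mpr ⟨Finset.mem_univ _, hk⟩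
    have : k ∈ Set.range (P.orderEmbOfFin rfl) := by
      rw [Finset.range_orderEmbOfFin]; exact hkP
    obtain ⟨x, hx⟩ := this
    exact ⟨x, hx⟩
  -- size bounds of the piece
  have hn_lo : Nb + 2 ≤ n := by
    by_contra hlt
    have h1 : n ≤ Nb + 1 := by omega
    have h2 := Nat.mul_le_mul_left m h1
    have h3 : m * (Nb + 1) ≤ Nb * (Nb + 1) := Nat.mul_le_mul_right _ hm
    omega
  have hn_hi : n ≤ r := (Finset.card_filter_le _ _).trans (by simp)
  -- apply `Stmt.pieceKill` to the restricted design
  have hS₁' : ((fun (_ : Fin 1) f => S p f) 0 f₁).Nonempty := hS₁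
  have hS₂' : ((fun (_ : Fin 1) f => S p f) 0 f₂).Nonempty := hS₂
  obtain ⟨v, hv, hsing⟩ := hPK h hH₀ D N n (fun _ f => S p f) (pieceDesign e c) hD hN
    (pieceDesign_injective e he p c hc hcp) (pieceDesign_live S e hlive p c hcp hsurj) ⟨f₁, f₂, hf, hS₁', hS₂'⟩
    hn_lo (by omega)
  exact not_uniform_of_pieceDesign e c v hsing (hU p n c hc hcp hsurj v hv)

end Summit.ValiantsHypothesis.ValiantsHypothesis.Theorems.BarrierLever.SimplexJoin
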